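import Summits.CriticalPhenomena.PercolationContinuityZ3.Theorems.PercNearOneGluingNoHeavyLowerTailSahiChainCubeTriangleFibres
import Summits.CriticalPhenomena.PercolationContinuityZ3.Theorems.PercNearOneGluingNoHeavyLowerTailSahiCombTriangleThinEdgeHolds
import Literature.Combinatorics.Sahi2008.PushForward
import Mathlib.Algebra.BigOperators.Ring.Finset
import Mathlib.Tactic.Linarith
import Mathlib.Tactic.Ring
import HarnessLib

/-!
# `NoHeavyLowerTail` (crux stmt-CriticalPhenomena-4575), P2: chain–cube–cube triangles, part 2/2 — Sahi's `C_3` for CHAIN–CUBE–CUBE triangles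

Support file (seat `prim-masterthm-p2`, gen 6; `--supports stmt-CriticalPhenomena-4575`).  No `sorry`, no named facts, standard axioms; two definitions
(`Phi`, `Psi`: the clone integrand and its symmetrisation).  Memo SAHI-ROUTE.md §4.19.  Part 1 (`…SahiChainCubeTriangleFibres`): `cubeW` and the antipodal-fibre identity.

THE THEOREM (`sahiE_three_nonneg_chainCubeCube`).  Let `γ` be a finite CHAIN with any probability weight `wC`, and let `2^A`, `2^B` be two finite
cubes with PRODUCT weights (`cubeW pA`, `cubeW pB`, `pA : A → [0,1]`).  For increasing events `f : γ → Finset A → {0,1}`, `g : γ → Finset B → {0,1}`,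
`h : Finset A → Finset B → {0,1}` (a "triangle": `f, g` share the chain, `f, h` share the first cube, `g, h` share the second cube), under the product
weight on `Finset A × Finset B × γ`:  `E_3(f,g,h) ≥ 0`.
This contains BOTH earlier theorems on the triangle class — the three-chain theorem `SahiChainTriangle.sahiE_three_nonneg` (a chain with any law
is an increasing image of a cube with a product law) and the thin-edge theorem `SahiHybrid.sahiE_three_nonneg_thinEdge'` at the law level (a chain
with two points is one coordinate) — and covers every class-T triple whose two `C`-sharing members see the block `C` through a common increasing
chain-valued statistic.

PROOF.  (1) Clone identity `E_3 = E6 Φ` (`SahiChainTriangle.sahiE_three_eq_tau`, representatives chosen so that `h` always reads `(a,b)`).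
(2) THE ANTIPODAL-FIBRE IDENTITY for a product weight on a cube (part 1, `sum_pairs_eq_sum_fibres`): `w(a)w(a') = w(a ∩ a')w(a ∪ a')`, and the clone pairs
`(a,a')` with `a ∩ a' = m`, `a ∪ a' = M` are exactly `(m ∪ η, M \ η)`, `η ⊆ M \ m` — an ANTIPODAL pair of the sub-cube `2^{M∖m}`.  Hence every law-level
clone integral over a cube is a nonnegative mixture of uniform antipodal sums over sub-cubes.  (3) For a fixed clone pair `c' ≤ c` of the chain the
sections `f c' ⊆ f c`, `g c' ⊆ g c` are NESTED, and the symmetrised antipodal fibre sum of `Φ` is literally prim-lf-1's thin-edge functional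
`LatticeFiveUpSet.triWOne` on the product cube `Finset ↥(M_A∖m_A) × Finset ↥(M_B∖m_B)` (`antipodal_thin_nonneg`, `fibre_thin_nonneg`), which is
`≥ 0` by `LatticeFiveUpSet.triWOne_nonneg_prod'` (the five-up-set inequality, `FiveUpSet.fiveUpSetIneq_holds`, prim-lf-1).  On a chain every clone
pair is comparable (`sahiE_three_nonneg_chainCubeCube`). ∎
-/

noncomputable section

open scoped Classical

namespace Summit.CriticalPhenomena.PercolationContinuityZ3.Theorems

namespace SahiChainCubeTriangle

open Finset
open Literature.Combinatorics.Sahi2008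
open SahiChainTriangle (E6 E6_congr E6_add E6_sub E6_smul E6_swap_a E6_swap_b E6_swap_c E6_cab tauABC tauA tauB tauC tau0
  sahiE_three_eq_tau)

/-! ### §3  The thin-edge theorem (prim-lf-1, `LatticeFiveUpSet.triWOne_nonneg_prod'`) in real-valued form on an antipodal fibre -/

section Thin

variable {β γ : Type} [Fintype β] [DecidableEq β] [Fintype γ] [DecidableEq γ]

open LatticeFiveUpSet (prodCompl prodCompl_apply triWOne triWOne_nonneg_prod')

/-- Membership in the antipodal image of a family of points of the product cube. [folklore] -/
theorem mem_image_prodCompl (X : Finset (Finset β × Finset γ)) (w : Finset β × Finset γ) :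
    w ∈ X.image (prodCompl β γ) ↔ (w.1ᶜ, w.2ᶜ) ∈ X := by
  rw [mem_image]
  constructor
  · rintro ⟨w', hw', rfl⟩
    rw [prodCompl_apply]
    simpa using hw'
  · intro h
    exact ⟨(w.1ᶜ, w.2ᶜ), h, by rw [prodCompl_apply]; simp⟩

/-- A triple intersection counted by indicators. [folklore] -/
theorem card_eq_sum_ind {W : Type} [Fintype W] [DecidableEq W] (P X Y : Finset W) :
    ((P ∩ X ∩ Y).card : ℝ) = ∑ w, (if w ∈ P then (1:ℝ) else 0) * ((if w ∈ X then (1:ℝ) else 0) * (if w ∈ Y then (1:ℝ) else 0)) := by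
  have h : (∑ w, if w ∈ P ∩ X ∩ Y then (1:ℝ) else 0) = ((univ.filter (· ∈ P ∩ X ∩ Y)).card : ℝ) := Finset.sum_boole _ _
  rw [Finset.filter_univ_mem] at h
  rw [← h]
  refine sum_congr rfl fun w _ => ?_
  simp only [mem_inter]
  by_cases hp : w ∈ P <;> by_cases hx : w ∈ X <;> by_cases hy : w ∈ Y <;> simp [hp, hx, hy]

/-- **The thin-edge functional of a nested pair on the product cube is `≥ 0`** — prim-lf-1's `triWOne_nonneg_prod'` (five-up-set inequality) read for
`{0,1}`-valued functions: `U₀ ≤ U₁` on `2^β`, `V₀ ≤ V₁` on `2^γ`, `T` on `2^β × 2^γ`, all increasing; `xᶜ` is the antipode. [this work, from prim-lf-1] -/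
theorem antipodal_thin_nonneg (U₀ U₁ : Finset β → ℝ) (V₀ V₁ : Finset γ → ℝ) (T : Finset β → Finset γ → ℝ)
    (hU₀ : ∀ x, U₀ x = 0 ∨ U₀ x = 1) (hU₁ : ∀ x, U₁ x = 0 ∨ U₁ x = 1)
    (hV₀ : ∀ y, V₀ y = 0 ∨ V₀ y = 1) (hV₁ : ∀ y, V₁ y = 0 ∨ V₁ y = 1) (hT : ∀ x y, T x y = 0 ∨ T x y = 1)
    (mU₀ : ∀ x x', x ⊆ x' → U₀ x ≤ U₀ x') (mU₁ : ∀ x x', x ⊆ x' → U₁ x ≤ U₁ x')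
    (mV₀ : ∀ y y', y ⊆ y' → V₀ y ≤ V₀ y') (mV₁ : ∀ y y', y ⊆ y' → V₁ y ≤ V₁ y')
    (mT : ∀ x x' y y', x ⊆ x' → y ⊆ y' → T x y ≤ T x' y')
    (hU : ∀ x, U₀ x ≤ U₁ x) (hV : ∀ y, V₀ y ≤ V₁ y) :
    0 ≤ ∑ x, ∑ y, T x y * (2 * (U₀ x * V₀ y + U₁ x * V₁ y) + (U₁ xᶜ * V₀ yᶜ + U₀ xᶜ * V₁ yᶜ)
        - (U₁ x * V₀ yᶜ + U₀ x * V₁ yᶜ) - (U₁ xᶜ * V₀ y + U₀ xᶜ * V₁ y) - (U₁ xᶜ * V₁ yᶜ + U₀ xᶜ * V₀ yᶜ)) := by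
  set P : Finset (Finset β × Finset γ) := univ.filter (fun w => T w.1 w.2 = 1) with hP
  set F₀ : Finset (Finset β × Finset γ) := univ.filter (fun w => U₀ w.1 = 1) with hF₀
  set F₁ : Finset (Finset β × Finset γ) := univ.filter (fun w => U₁ w.1 = 1) with hF₁
  set G₀ : Finset (Finset β × Finset γ) := univ.filter (fun w => V₀ w.2 = 1) with hG₀
  set G₁ : Finset (Finset β × Finset γ) := univ.filter (fun w => V₁ w.2 = 1) with hG₁
  -- values in {0,1}: `r = 1` as an indicator is `r` itself
  have ind : ∀ r : ℝ, (r = 0 ∨ r = 1) → (if r = 1 then (1:ℝ) else 0) = r := by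
    rintro r (rfl | rfl) <;> norm_num
  have iP : ∀ w : Finset β × Finset γ, (if w ∈ P then (1:ℝ) else 0) = T w.1 w.2 := fun w => by
    rw [hP]; simp only [mem_filter, mem_univ, true_and]; exact ind _ (hT _ _)
  have iF₀ : ∀ w : Finset β × Finset γ, (if w ∈ F₀ then (1:ℝ) else 0) = U₀ w.1 := fun w => by
    rw [hF₀]; simp only [mem_filter, mem_univ, true_and]; exact ind _ (hU₀ _)
  have iF₁ : ∀ w : Finset β × Finset γ, (if w ∈ F₁ then (1:ℝ) else 0) = U₁ w.1 := fun w => by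
    rw [hF₁]; simp only [mem_filter, mem_univ, true_and]; exact ind _ (hU₁ _)
  have iG₀ : ∀ w : Finset β × Finset γ, (if w ∈ G₀ then (1:ℝ) else 0) = V₀ w.2 := fun w => by
    rw [hG₀]; simp only [mem_filter, mem_univ, true_and]; exact ind _ (hV₀ _)
  have iG₁ : ∀ w : Finset β × Finset γ, (if w ∈ G₁ then (1:ℝ) else 0) = V₁ w.2 := fun w => by
    rw [hG₁]; simp only [mem_filter, mem_univ, true_and]; exact ind _ (hV₁ _)
  have jF₀ : ∀ w : Finset β × Finset γ, (if w ∈ F₀.image (prodCompl β γ) then (1:ℝ) else 0) = U₀ w.1ᶜ := fun w => by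
    simp only [mem_image_prodCompl, hF₀, mem_filter, mem_univ, true_and]; exact ind _ (hU₀ _)
  have jF₁ : ∀ w : Finset β × Finset γ, (if w ∈ F₁.image (prodCompl β γ) then (1:ℝ) else 0) = U₁ w.1ᶜ := fun w => by
    simp only [mem_image_prodCompl, hF₁, mem_filter, mem_univ, true_and]; exact ind _ (hU₁ _)
  have jG₀ : ∀ w : Finset β × Finset γ, (if w ∈ G₀.image (prodCompl β γ) then (1:ℝ) else 0) = V₀ w.2ᶜ := fun w => by
    simp only [mem_image_prodCompl, hG₀, mem_filter, mem_univ, true_and]; exact ind _ (hV₀ _)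
  have jG₁ : ∀ w : Finset β × Finset γ, (if w ∈ G₁.image (prodCompl β γ) then (1:ℝ) else 0) = V₁ w.2ᶜ := fun w => by
    simp only [mem_image_prodCompl, hG₁, mem_filter, mem_univ, true_and]; exact ind _ (hV₁ _)
  -- the sum IS `triWOne`
  have key : (∑ x, ∑ y, T x y * (2 * (U₀ x * V₀ y + U₁ x * V₁ y) + (U₁ xᶜ * V₀ yᶜ + U₀ xᶜ * V₁ yᶜ)
        - (U₁ x * V₀ yᶜ + U₀ x * V₁ yᶜ) - (U₁ xᶜ * V₀ y + U₀ xᶜ * V₁ y) - (U₁ xᶜ * V₁ yᶜ + U₀ xᶜ * V₀ yᶜ))) =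
      ((triWOne (prodCompl β γ) P F₀ F₁ G₀ G₁ : ℤ) : ℝ) := by
    rw [triWOne]
    push_cast
    simp only [card_eq_sum_ind, iP, iF₀, iF₁, iG₀, iG₁, jF₀, jF₁, jG₀, jG₁]
    rw [← Fintype.sum_prod_type']
    simp only [Finset.mul_sum, ← Finset.sum_add_distrib, ← Finset.sum_sub_distrib]
    exact sum_congr rfl fun w _ => by ring
  rw [key]
  -- hypotheses of the thin-edge theorem
  have one_of : ∀ r s : ℝ, (s = 0 ∨ s = 1) → r = 1 → r ≤ s → s = 1 := by
    rintro r s (rfl | rfl) hr hrs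
    · rw [hr] at hrs; norm_num at hrs
    · rfl
  have hPu : IsUpperSet (P : Set (Finset β × Finset γ)) := by
    intro w w' hle hw
    rw [mem_coe, hP, mem_filter] at hw ⊢
    exact ⟨mem_univ _, one_of _ _ (hT _ _) hw.2 (mT _ _ _ _ hle.1 hle.2)⟩
  have hF₀u : IsUpperSet (F₀ : Set (Finset β × Finset γ)) := by
    intro w w' hle hw
    rw [mem_coe, hF₀, mem_filter] at hw ⊢
    exact ⟨mem_univ _, one_of _ _ (hU₀ _) hw.2 (mU₀ _ _ hle.1)⟩
  have hF₁u : IsUpperSet (F₁ : Set (Finset β × Finset γ)) := by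
    intro w w' hle hw
    rw [mem_coe, hF₁, mem_filter] at hw ⊢
    exact ⟨mem_univ _, one_of _ _ (hU₁ _) hw.2 (mU₁ _ _ hle.1)⟩
  have hG₀u : IsUpperSet (G₀ : Set (Finset β × Finset γ)) := by
    intro w w' hle hw
    rw [mem_coe, hG₀, mem_filter] at hw ⊢
    exact ⟨mem_univ _, one_of _ _ (hV₀ _) hw.2 (mV₀ _ _ hle.2)⟩
  have hG₁u : IsUpperSet (G₁ : Set (Finset β × Finset γ)) := by
    intro w w' hle hw
    rw [mem_coe, hG₁, mem_filter] at hw ⊢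
    exact ⟨mem_univ _, one_of _ _ (hV₁ _) hw.2 (mV₁ _ _ hle.2)⟩
  have hF : F₀ ⊆ F₁ := by
    intro w hw
    rw [hF₀, mem_filter] at hw
    rw [hF₁, mem_filter]
    exact ⟨mem_univ _, one_of _ _ (hU₁ _) hw.2 (hU _)⟩
  have hG : G₀ ⊆ G₁ := by
    intro w hw
    rw [hG₀, mem_filter] at hw
    rw [hG₁, mem_filter]
    exact ⟨mem_univ _, one_of _ _ (hV₁ _) hw.2 (hV _)⟩
  exact_mod_cast triWOne_nonneg_prod' β γ P F₀ F₁ G₀ G₁ hPu hF₀u hF₁u hG₀u hG₁u hF hG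

end Thin

/-! ### §3b  The same on an antipodal fibre `{(m ∪ η, M \ η)}` of two cubes `2^A`, `2^B` -/

section Fibre

variable {A B : Type} [Fintype A] [DecidableEq A] [Fintype B] [DecidableEq B]

omit [Fintype A] [Fintype B] in
/-- **Nonnegativity of the thin-edge functional on an antipodal fibre**: for `{0,1}`-valued increasing `u₀ ≤ u₁` (on `2^A`), `v₀ ≤ v₁` (on `2^B`),
`t` (on `2^A × 2^B`) and `mA ⊆ MA`, `mB ⊆ MB`, the symmetrised antipodal fibre sum is `≥ 0`. [this work] -/
theorem fibre_thin_nonneg (u₀ u₁ : Finset A → ℝ) (v₀ v₁ : Finset B → ℝ) (t : Finset A → Finset B → ℝ)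
    (hu₀ : ∀ a, u₀ a = 0 ∨ u₀ a = 1) (hu₁ : ∀ a, u₁ a = 0 ∨ u₁ a = 1)
    (hv₀ : ∀ b, v₀ b = 0 ∨ v₀ b = 1) (hv₁ : ∀ b, v₁ b = 0 ∨ v₁ b = 1) (ht : ∀ a b, t a b = 0 ∨ t a b = 1)
    (mu₀ : ∀ a a', a ⊆ a' → u₀ a ≤ u₀ a') (mu₁ : ∀ a a', a ⊆ a' → u₁ a ≤ u₁ a')
    (mv₀ : ∀ b b', b ⊆ b' → v₀ b ≤ v₀ b') (mv₁ : ∀ b b', b ⊆ b' → v₁ b ≤ v₁ b')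
    (mt : ∀ a a' b b', a ⊆ a' → b ⊆ b' → t a b ≤ t a' b')
    (hu : ∀ a, u₀ a ≤ u₁ a) (hv : ∀ b, v₀ b ≤ v₁ b)
    {mA MA : Finset A} (hmA : mA ⊆ MA) {mB MB : Finset B} (hmB : mB ⊆ MB) :
    0 ≤ ∑ η ∈ (MA \ mA).powerset, ∑ ζ ∈ (MB \ mB).powerset,
      t (mA ∪ η) (mB ∪ ζ) * (2 * (u₀ (mA ∪ η) * v₀ (mB ∪ ζ) + u₁ (mA ∪ η) * v₁ (mB ∪ ζ))
        + (u₁ (MA \ η) * v₀ (MB \ ζ) + u₀ (MA \ η) * v₁ (MB \ ζ))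
        - (u₁ (mA ∪ η) * v₀ (MB \ ζ) + u₀ (mA ∪ η) * v₁ (MB \ ζ))
        - (u₁ (MA \ η) * v₀ (mB ∪ ζ) + u₀ (MA \ η) * v₁ (mB ∪ ζ))
        - (u₁ (MA \ η) * v₁ (MB \ ζ) + u₀ (MA \ η) * v₀ (MB \ ζ))) := by
  rw [sum_powerset_eq_sum_subtype]
  simp_rw [sum_powerset_eq_sum_subtype (MB \ mB), sdiff_map_eq_union_map_compl hmA, sdiff_map_eq_union_map_compl hmB]
  refine antipodal_thin_nonneg
    (fun x => u₀ (mA ∪ x.map (Function.Embedding.subtype _))) (fun x => u₁ (mA ∪ x.map (Function.Embedding.subtype _)))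
    (fun y => v₀ (mB ∪ y.map (Function.Embedding.subtype _))) (fun y => v₁ (mB ∪ y.map (Function.Embedding.subtype _)))
    (fun x y => t (mA ∪ x.map (Function.Embedding.subtype _)) (mB ∪ y.map (Function.Embedding.subtype _)))
    (fun x => hu₀ _) (fun x => hu₁ _) (fun y => hv₀ _) (fun y => hv₁ _) (fun x y => ht _ _)
    (fun x x' h => mu₀ _ _ (union_subset_union (Subset.refl _) (map_subset_map.2 h)))
    (fun x x' h => mu₁ _ _ (union_subset_union (Subset.refl _) (map_subset_map.2 h)))
    (fun y y' h => mv₀ _ _ (union_subset_union (Subset.refl _) (map_subset_map.2 h)))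
    (fun y y' h => mv₁ _ _ (union_subset_union (Subset.refl _) (map_subset_map.2 h)))
    (fun x x' y y' hx hy => mt _ _ _ _ (union_subset_union (Subset.refl _) (map_subset_map.2 hx))
      (union_subset_union (Subset.refl _) (map_subset_map.2 hy)))
    (fun x => hu _) (fun y => hv _)

end Fibre

/-! ### §4  Assembly: `C_3` for chain–cube–cube triangles -/

section Main

variable {A B γ : Type} [Fintype A] [DecidableEq A] [Fintype B] [DecidableEq B] [Fintype γ]
  (pA : A → ℝ) (pB : B → ℝ) (wC : γ → ℝ) (f : γ → Finset A → ℝ) (g : γ → Finset B → ℝ) (h : Finset A → Finset B → ℝ)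

/-- The clone integrand of `E_3` with representatives in which `h` always reads `(a, b)`:
`Φ = h(a,b)·[2 f(c,a)g(c,b) + f(c,a')g(c',b') − f(c,a)g(c',b') − f(c,a')g(c',b) − f(c,a')g(c,b')]`
(patterns `ABC, ∅, A, B, C`). [this work] -/
def Phi : Finset A → Finset A → Finset B → Finset B → γ → γ → ℝ := fun a a' b b' c c' =>
  h a b * (2 * (f c a * g c b) + f c a' * g c' b' - f c a * g c' b' - f c a' * g c' b - f c a' * g c b')

/-- `Φ` symmetrised in the two clones of the chain. [this work] -/
def Psi : Finset A → Finset A → Finset B → Finset B → γ → γ → ℝ := fun a a' b b' c c' =>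
  Phi f g h a a' b b' c c' + Phi f g h a a' b b' c' c

/-- **`E_3 = E6 Φ`**: Sahi's third functional of the triangle as the clone integral of `Φ` (from `SahiChainTriangle.sahiE_three_eq_tau`). [this work] -/
theorem sahiE_three_eq_E6_Phi (hC : ∑ c, wC c = 1) :
    sahiE (fun q : Finset A × Finset B × γ => cubeW pA q.1 * cubeW pB q.2.1 * wC q.2.2) 3
        ![fun q => f q.2.2 q.1, fun q => g q.2.2 q.2.1, fun q => h q.1 q.2.1] =
      E6 (cubeW pA) (cubeW pB) wC (Phi f g h) := by
  rw [sahiE_three_eq_tau (cubeW pA) (cubeW pB) wC f g h (sum_cubeW pA) (sum_cubeW pB) hC]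
  set wA := cubeW pA with hwA
  set wB := cubeW pB with hwB
  have t0 : E6 wA wB wC (fun a a' b b' c c' => f c a' * g c' b' * h a b) = tau0 wA wB wC f g h := by
    rw [tau0]
    calc E6 wA wB wC (fun a a' b b' c c' => f c a' * g c' b' * h a b)
        = E6 wA wB wC (fun a a' b b' c c' => f c a * g c' b' * h a' b) := by
          rw [← E6_swap_a wA wB wC (fun a a' b b' c c' => f c a * g c' b' * h a' b)]
      _ = E6 wA wB wC (fun a a' b b' c c' => f c a * g c' b * h a' b') := by
          rw [← E6_swap_b wA wB wC (fun a a' b b' c c' => f c a * g c' b * h a' b')]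
  have tA : E6 wA wB wC (fun a a' b b' c c' => f c a * g c' b' * h a b) = tauA wA wB wC f g h := by
    rw [tauA, ← E6_swap_b wA wB wC (fun a a' b b' c c' => f c a * g c' b * h a b')]
  have tB : E6 wA wB wC (fun a a' b b' c c' => f c a' * g c' b * h a b) = tauB wA wB wC f g h := by
    rw [tauB, ← E6_swap_a wA wB wC (fun a a' b b' c c' => f c a * g c' b * h a' b)]
  have tC : E6 wA wB wC (fun a a' b b' c c' => f c a' * g c b' * h a b) = tauC wA wB wC f g h := by
    rw [tauC]
    calc E6 wA wB wC (fun a a' b b' c c' => f c a' * g c b' * h a b)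
        = E6 wA wB wC (fun a a' b b' c c' => f c a * g c b' * h a' b) := by
          rw [← E6_swap_a wA wB wC (fun a a' b b' c c' => f c a * g c b' * h a' b)]
      _ = E6 wA wB wC (fun a a' b b' c c' => f c a * g c b * h a' b') := by
          rw [← E6_swap_b wA wB wC (fun a a' b b' c c' => f c a * g c b * h a' b')]
  have tABC : E6 wA wB wC (fun a a' b b' c c' => f c a * g c b * h a b) = tauABC wA wB wC f g h := by
    rw [tauABC]
  have lin : E6 wA wB wC (Phi f g h) = 2 * E6 wA wB wC (fun a a' b b' c c' => f c a * g c b * h a b)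
      + E6 wA wB wC (fun a a' b b' c c' => f c a' * g c' b' * h a b)
      - E6 wA wB wC (fun a a' b b' c c' => f c a * g c' b' * h a b)
      - E6 wA wB wC (fun a a' b b' c c' => f c a' * g c' b * h a b)
      - E6 wA wB wC (fun a a' b b' c c' => f c a' * g c b' * h a b) := by
    rw [← E6_smul, ← E6_add, ← E6_sub, ← E6_sub, ← E6_sub]
    exact E6_congr wA wB wC fun a a' b b' c c' => by simp only [Phi]; ring
  rw [lin, t0, tA, tB, tC, tABC]
  ring

omit [Fintype A] [DecidableEq A] [DecidableEq B] in
/-- Moving a fibre sum inside a clone double sum. [folklore] -/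
theorem sum_fibre_comm (PA : Finset (Finset A)) (w : Finset B → ℝ) (G : Finset A → Finset B → Finset B → ℝ) :
    ∑ η ∈ PA, ∑ b, ∑ b', w b * w b' * G η b b' = ∑ b, ∑ b', w b * w b' * ∑ η ∈ PA, G η b b' := by
  rw [sum_comm]
  refine sum_congr rfl fun b _ => ?_
  rw [sum_comm]
  refine sum_congr rfl fun b' _ => ?_
  rw [mul_sum]

/-- **THEOREM (Sahi's `C_3` for CHAIN–CUBE–CUBE triangles).**  `γ` a finite chain with a probability weight `wC`; `2^A`, `2^B` finite cubes with
product weights `cubeW pA`, `cubeW pB` (`pA, pB` valued in `[0,1]`); `f : γ × 2^A → {0,1}`, `g : γ × 2^B → {0,1}`, `h : 2^A × 2^B → {0,1}` increasing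
(in the chain order and in `⊆`).  Then `E_3(μ; f, g, h) ≥ 0` for the product weight `μ` on `2^A × 2^B × γ`.
Contains the three-chain theorem (`SahiChainTriangle.sahiE_three_nonneg`, via increasing images of cubes) and the law-level thin-edge theorem
(`SahiHybrid.sahiE_three_nonneg_thinEdge'`, `γ` = two points) on the triangle class; new for `|γ| ≥ 3` with cube blocks of dimension `≥ 2`. [this work] -/
theorem sahiE_three_nonneg_chainCubeCube [LinearOrder γ]
    (hpA : ∀ i, 0 ≤ pA i ∧ pA i ≤ 1) (hpB : ∀ j, 0 ≤ pB j ∧ pB j ≤ 1) (hC0 : ∀ c, 0 ≤ wC c) (hC : ∑ c, wC c = 1)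
    (hf : ∀ c a, f c a = 0 ∨ f c a = 1) (hg : ∀ c b, g c b = 0 ∨ g c b = 1) (hh : ∀ a b, h a b = 0 ∨ h a b = 1)
    (mf : ∀ c c' a a', c ≤ c' → a ⊆ a' → f c a ≤ f c' a') (mg : ∀ c c' b b', c ≤ c' → b ⊆ b' → g c b ≤ g c' b')
    (mh : ∀ a a' b b', a ⊆ a' → b ⊆ b' → h a b ≤ h a' b') :
    0 ≤ sahiE (fun q : Finset A × Finset B × γ => cubeW pA q.1 * cubeW pB q.2.1 * wC q.2.2) 3
        ![fun q => f q.2.2 q.1, fun q => g q.2.2 q.2.1, fun q => h q.1 q.2.1] := by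
  rw [sahiE_three_eq_E6_Phi pA pB wC f g h hC]
  -- symmetrise in the two clones of the chain
  have hsym : 2 * E6 (cubeW pA) (cubeW pB) wC (Phi f g h) = E6 (cubeW pA) (cubeW pB) wC (Psi f g h) := by
    rw [show Psi f g h = fun a a' b b' c c' => Phi f g h a a' b b' c c' + Phi f g h a a' b b' c' c from rfl,
      E6_add, E6_swap_c]
    ring
  suffices hmain : 0 ≤ E6 (cubeW pA) (cubeW pB) wC (Psi f g h) by linarith
  -- clones of the chain outermost; they are comparable
  rw [E6_cab]
  refine sum_nonneg fun c _ => sum_nonneg fun c' _ => mul_nonneg (mul_nonneg (hC0 c) (hC0 c')) ?_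
  -- the antipodal-fibre identity on the cube `2^A`
  rw [sum_pairs_eq_sum_fibres pA]
  refine sum_nonneg fun MA _ => sum_nonneg fun mA hmA => mul_nonneg (mul_nonneg (cubeW_nonneg hpA _) (cubeW_nonneg hpA _)) ?_
  rw [mem_powerset] at hmA
  -- the antipodal-fibre identity on the cube `2^B`
  rw [sum_fibre_comm, sum_pairs_eq_sum_fibres pB]
  refine sum_nonneg fun MB _ => sum_nonneg fun mB hmB => mul_nonneg (mul_nonneg (cubeW_nonneg hpB _) (cubeW_nonneg hpB _)) ?_
  rw [mem_powerset] at hmB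
  rw [sum_comm]
  -- the symmetrised fibre sum is the thin-edge functional of the nested pair (f c₋ ⊆ f c₊, g c₋ ⊆ g c₊)
  rcases le_total c' c with hcc | hcc
  · have key := fibre_thin_nonneg (f c') (f c) (g c') (g c) h (hf c') (hf c) (hg c') (hg c) hh
      (fun a a' ha => mf c' c' a a' le_rfl ha) (fun a a' ha => mf c c a a' le_rfl ha)
      (fun b b' hb => mg c' c' b b' le_rfl hb) (fun b b' hb => mg c c b b' le_rfl hb) mh
      (fun a => mf c' c a a hcc (Subset.refl a)) (fun b => mg c' c b b hcc (Subset.refl b)) hmA hmB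
    refine le_of_le_of_eq key (sum_congr rfl fun η _ => sum_congr rfl fun ζ _ => ?_)
    simp only [Psi, Phi]
    ring
  · have key := fibre_thin_nonneg (f c) (f c') (g c) (g c') h (hf c) (hf c') (hg c) (hg c') hh
      (fun a a' ha => mf c c a a' le_rfl ha) (fun a a' ha => mf c' c' a a' le_rfl ha)
      (fun b b' hb => mg c c b b' le_rfl hb) (fun b b' hb => mg c' c' b b' le_rfl hb) mh
      (fun a => mf c c' a a hcc (Subset.refl a)) (fun b => mg c c' b b hcc (Subset.refl b)) hmA hmB
    refine le_of_le_of_eq key (sum_congr rfl fun η _ => sum_congr rfl fun ζ _ => ?_)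
    simp only [Psi, Phi]
    ring

end Main

/-! ### §5  Corollary: cube triples whose `C`-sharing members factor through a common increasing chain statistic -/

section Statistic

variable {A B C γ : Type} [Fintype A] [DecidableEq A] [Fintype B] [DecidableEq B] [Fintype C] [DecidableEq C] [Fintype γ]

omit [DecidableEq C] in
/-- Pushing a triple product weight forward along a map of the last factor. [folklore] -/
theorem pushWeight_prod_map {W : Type} [Fintype W] [DecidableEq W] (u : Finset A → ℝ) (v : Finset B → ℝ) (w : Finset C → ℝ)
    (s : Finset C → W) :
    pushWeight (fun r : Finset A × Finset B × Finset C => u r.1 * v r.2.1 * w r.2.2) (fun r => (r.1, r.2.1, s r.2.2))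
      = fun q : Finset A × Finset B × W => u q.1 * v q.2.1 * pushWeight w s q.2.2 := by
  funext q
  obtain ⟨q1, q2, q3⟩ := q
  rw [pushWeight_apply, pushWeight_apply, mul_sum, Fintype.sum_prod_type]
  simp_rw [Fintype.sum_prod_type]
  simp only [Prod.mk.injEq]
  rw [Finset.sum_eq_single q1]
  · rw [Finset.sum_eq_single q2]
    · simp only [true_and]
      refine sum_congr rfl fun z _ => ?_
      split_ifs <;> ring
    · intro y _ hy
      exact sum_eq_zero fun z _ => by rw [if_neg (fun h => hy h.2.1)]
    · intro h; exact absurd (mem_univ _) h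
  · intro x _ hx
    exact sum_eq_zero fun y _ => sum_eq_zero fun z _ => by rw [if_neg (fun h => hx h.1)]
  · intro h; exact absurd (mem_univ _) h

/-- **COROLLARY (class-T triples through a chain statistic).**  On the cube `2^A × 2^B × 2^C` with a product weight, let the two members sharing the
block `C` see `x_C` only through a common increasing statistic `s : 2^C → γ` with values in a chain (`f(x,a) = f'(s x, a)`, `g(x,b) = g'(s x, b)`,
`f', g'` increasing in the chain order), and let `h(a,b)` be any increasing event on `2^A × 2^B`.  Then `E_3 ≥ 0`.  (Examples: `s x = |x ∩ S|`-type
threshold flags, `max{i : x ⊇ S_i}` along a chain `S_1 ⊆ S_2 ⊆ ⋯`; `|γ| = 2` is the thin edge.) [this work] -/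
theorem sahiE_three_nonneg_of_chainStatistic [LinearOrder γ] (pA : A → ℝ) (pB : B → ℝ) (pC : C → ℝ)
    (hpA : ∀ i, 0 ≤ pA i ∧ pA i ≤ 1) (hpB : ∀ j, 0 ≤ pB j ∧ pB j ≤ 1) (hpC : ∀ k, 0 ≤ pC k ∧ pC k ≤ 1)
    (s : Finset C → γ) (f' : γ → Finset A → ℝ) (g' : γ → Finset B → ℝ) (h : Finset A → Finset B → ℝ)
    (hf : ∀ c a, f' c a = 0 ∨ f' c a = 1) (hg : ∀ c b, g' c b = 0 ∨ g' c b = 1) (hh : ∀ a b, h a b = 0 ∨ h a b = 1)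
    (mf : ∀ c c' a a', c ≤ c' → a ⊆ a' → f' c a ≤ f' c' a') (mg : ∀ c c' b b', c ≤ c' → b ⊆ b' → g' c b ≤ g' c' b')
    (mh : ∀ a a' b b', a ⊆ a' → b ⊆ b' → h a b ≤ h a' b') :
    0 ≤ sahiE (fun r : Finset A × Finset B × Finset C => cubeW pA r.1 * cubeW pB r.2.1 * cubeW pC r.2.2) 3
        ![fun r => f' (s r.2.2) r.1, fun r => g' (s r.2.2) r.2.1, fun r => h r.1 r.2.1] := by
  have key := sahiE_three_nonneg_chainCubeCube pA pB (pushWeight (cubeW pC) s) f' g' h hpA hpB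
    (fun c => pushWeight_nonneg (cubeW_nonneg hpC) s c) (by rw [sum_pushWeight, sum_cubeW]) hf hg hh mf mg mh
  rw [← pushWeight_prod_map, sahiE_pushWeight] at key
  convert key using 2
  funext i
  fin_cases i <;> rfl

end Statistic


end SahiChainCubeTriangle

end Summit.CriticalPhenomena.PercolationContinuityZ3.Theorems
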